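import Mathlib
import Summits.MatrixMultiplication.MatrixMultiplication.Theses.SnSubsetDichotomy
import Literature.RepresentationTheory.FiniteGroups.KLRGradedCellularBasis
import Literature.Barriers.MatrixMultiplication.NilpotentGroupBarrierSemisimple
import Summits.MatrixMultiplication.MatrixMultiplication.Theorems.SnSubsetDichotomyNoThresholdSubsetTripleStubGradedCodim
import Summits.MatrixMultiplication.MatrixMultiplication.Theorems.SnSubsetDichotomyNoThresholdSubsetTripleStubSavingTransfer

/-!
# `SnSubsetDichotomy.NoThresholdSubsetTriple`, line `klr-graded-polynomial-method`:
# stub `noThresholdSubsetTriple_of_klr_pairWindow` (bridge W: K3 ∧ window → crux)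

The KLR graded polynomial method as a standalone bridge from its degree-WINDOW form. Index the
Hu–Mathas graded block basis of `𝔽₂[S_n]` by `TableauPair n` (same-shape pairs `(μ, S, T)` of
standard tableaux), with degree `X i = TableauPair.degree 2 i = deg₂ S + deg₂ T`, block label
`TableauPair.content 2 i`, `2`-weight `w = c₀ − (c₀ − c₁)²` (`cⱼ` = number of cells of residue `j`)
and cut `a = ⌈2w/3⌉ = ⌊(2w + 2)/3⌋`. If

* **K3** — `KLRGradedCellularBasis` (Hu–Mathas 2010: a basis of `𝔽_p[S_n]` indexed by
  `TableauPair n`, multiplicative in (content, degree)), and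
* **WINDOW** — `2·#{i : X i < a} + #{i : 2a ≤ X i} ≤ n!·e^{-c√n}` for all large `n`,

then `NoThresholdSubsetTriple`. Proof: `stub_gradedCodim` (K1, BCCGU 2017 Prop. 3.2 for
`ℤ`-graded block bases) on the K3 basis of `𝔽₂[S_n]` with the cut `a` bounds
`slice-rank_{𝔽₂} D_{S_n}` by exactly the window count, and `stub_savingTransfer` turns the
resulting modular slice-rank saving (prime `p = 2`) into the crux.
-/

namespace Summit.MatrixMultiplication.MatrixMultiplication.Theorems

open Literature.RepresentationTheory.FiniteGroups (TableauPair KLRGradedCellularBasis residueContent tableauDegree)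
open Literature.Barriers.MatrixMultiplication (sliceRank mulGroupTensor)
open scoped BigOperators

set_option linter.dupNamespace false in -- deliberate Summit.<S>.<P> duplicate
/-- **Stub `noThresholdSubsetTriple_of_klr_pairWindow` (bridge W of line
`klr-graded-polynomial-method`, crux `SnSubsetDichotomy.NoThresholdSubsetTriple`,
stmt-MatrixMultiplication-8302).** If `𝔽_p[S_n]` has the Hu–Mathas graded block basis
(`KLRGradedCellularBasis`, K3) and, with `X i = deg₂ S + deg₂ T`, `w = c₀ − (c₀ − c₁)²` the
`2`-weight of the shape and `a = ⌊(2w + 2)/3⌋`, the window count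
`2·#{X < a} + #{2a ≤ X}` is at most `n!·e^{-c√n}` for all large `n`, then every TPP triple
`S, T, U ⊆ S_n` has `|S||T||U| ≤ (n!)^{3/2}·e^{-c'√n}` for large `n` (`NoThresholdSubsetTriple`).
Proof: `stub_gradedCodim` on the K3 basis of `𝔽₂[S_n]` with the block-dependent cut `a` gives
`slice-rank_{𝔽₂} D_{S_n} ≤ 2·#{X < a} + #{2a ≤ X}`; chain with the window bound and apply
`stub_savingTransfer` (prime `p = 2`). [folklore] -/
theorem noThresholdSubsetTriple_of_klr_pairWindow : Literature.RepresentationTheory.FiniteGroups.KLRGradedCellularBasis → (∃ c : ℝ, 0 < c ∧ ∃ n₀ : ℕ, ∀ n ≥ n₀, ((2 * Nat.card {i : TableauPair n // TableauPair.degree 2 i < (2 * ((TableauPair.content 2 i 0 : ℤ) - ((TableauPair.content 2 i 0 : ℤ) - (TableauPair.content 2 i 1 : ℤ)) ^ 2) + 2) / 3} + Nat.card {i : TableauPair n // 2 * ((2 * ((TableauPair.content 2 i 0 : ℤ) - ((TableauPair.content 2 i 0 : ℤ) - (TableauPair.content 2 i 1 : ℤ)) ^ 2) + 2) / 3) ≤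 TableauPair.degree 2 i} : ℕ) : ℝ) ≤ (n.factorial : ℝ) * Real.exp (-(c * Real.sqrt (n : ℝ)))) → Summit.MatrixMultiplication.MatrixMultiplication.Theses.SnSubsetDichotomy.NoThresholdSubsetTriple := by
  intro hK hW
  obtain ⟨c, hc, n₀, hW⟩ := hW
  -- the transfer: it suffices to bound `slice-rank_{𝔽₂} D_{S_n}` for `n ≥ n₀`
  refine stub_savingTransfer ⟨c, hc, n₀, fun n hn => ⟨2, Nat.prime_two, ?_⟩⟩
  -- K3: the graded block basis of `𝔽₂[S_n]`
  obtain ⟨β, hβ⟩ := hK 2 n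
  -- K1 on that basis with the cut `a = ⌈2w/3⌉`
  have hN : sliceRank (mulGroupTensor (ZMod 2) (Equiv.Perm (Fin n))) ≤
      2 * Nat.card {i : TableauPair n // TableauPair.degree 2 i <
          (2 * ((TableauPair.content 2 i 0 : ℤ) -
            ((TableauPair.content 2 i 0 : ℤ) - (TableauPair.content 2 i 1 : ℤ)) ^ 2) + 2) / 3} +
        Nat.card {i : TableauPair n // 2 * ((2 * ((TableauPair.content 2 i 0 : ℤ) -
            ((TableauPair.content 2 i 0 : ℤ) - (TableauPair.content 2 i 1 : ℤ)) ^ 2) + 2) / 3) ≤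
          TableauPair.degree 2 i} :=
    stub_gradedCodim (ZMod 2) (Equiv.Perm (Fin n)) (TableauPair n) (ZMod 2 → ℕ) β
      (TableauPair.degree 2) (TableauPair.content 2) hβ
      (fun κ : ZMod 2 → ℕ => (2 * ((κ 0 : ℤ) - ((κ 0 : ℤ) - (κ 1 : ℤ)) ^ 2) + 2) / 3)
  -- cast to `ℝ` (the cast stays on the whole `ℕ`-sum, as in the window hypothesis) and chain
  exact (Nat.cast_le (α := ℝ) |>.2 hN).trans (hW n hn)

end Summit.MatrixMultiplication.MatrixMultiplication.Theorems
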